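import Mathlib
import Literature.AlgebraicGeometry.Resolution.AffineBlowupRegular
import Literature.AlgebraicGeometry.Resolution.AffineBlowupIntegral
import Literature.AlgebraicGeometry.Resolution.BlowupChartRsop

/-!
# Rung V3 (one blow-up model): `Bl_{K₃} 𝔸ⁿ` is regular, integral, and proper birational over `𝔸ⁿ` — given its four vertex charts

(crux stmt-ResolutionOfSingularities-15640 `WildQuotients.WildQuotientResolution`, line `Sketch`,
sector `|G| = p`; rung V3 of `L/w45c/CHAIN.md` v4, ONE-BLOW-UP design of record (lead-1 RULING
2026-08-27T01:07:58Z); part (c) of stub-4's split, in the HYPOTHESIS-COMPOSED form: the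
regularity of the four Newton-vertex chart rings `(R[K₃t])_{(c_j t)}`, `j = 0, 1, 3, 4`
(stub-4 `…JordanThreeChartsA` / `…JordanThreeChartB2a`: `j = 0, 1`; stub-2: `j = 3, 4`) enters as
four hypotheses; the unconditional composite is a one-liner once all four land.
[OURS · L1 W4.5c] — NOT a statement of any manuscript; replaces the role of no printed item.)

`K₃ = (x_a⁴, x_a³x_b, x_a²x_b³, x_a x_b⁴, x_b⁶)` (generator vector of record
`![X a ^ 4, X a ^ 3 * X b, X a ^ 2 * X b ^ 3, X a * X b ^ 4, X b ^ 6]`).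

* `isRegular_affineBlowup_of_charts` — GENERIC: `Bl_I(Spec R)`, `I = (c_0,…,c_{m−1})`, is a
  regular scheme as soon as every generator chart `D₊(c_i t)` is contained in a generator chart
  `D₊(c_j t)` whose chart ring is regular (cover `affineBlowup.iSup_basicOpen_reesT_generators_eq_top`
  + `Proj.awayι`, pattern `affineBlowup.isRegular_of_isQuasiRegular`).
* `reesT_k3_two_sq` / `basicOpen_k3_two_le` — the fifth chart of `Bl_{K₃}` is redundant:
  `(x_a²x_b³ t)² = (x_a³x_b t)·(x_b · x_a x_b⁴ t)` in the Rees algebra, so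
  `D₊(x_a²x_b³ t) ⊆ D₊(x_a³x_b t)`.
* `k3_blowup_regular_of_charts` — `Scheme.IsRegular (affineBlowup K₃) ∧ IsIntegral _ ∧
  IsProper (affineBlowup.π K₃) ∧ IsBirational (affineBlowup.π K₃)` from the four chart
  hypotheses (`affineBlowup.isIntegral` / `isBirational` for `K₃ ≠ ⊥`, properness for Noetherian
  `R`).
-/

-- single-problem summit: the doubled namespace component `ResolutionOfSingularities` is forced
set_option linter.dupNamespace false

noncomputable section

open MvPolynomial AlgebraicGeometry CategoryTheory TopologicalSpace
open Literature.AlgebraicGeometry.Resolution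

namespace Summit.ResolutionOfSingularities.ResolutionOfSingularities.Theorems.WildQuotientResolution.JordanThree

universe u

/-- **Regularity of an affine blow-up from regular generator charts** (generic): if every
generator chart `D₊(c_i t)` of `Bl_I(Spec R) = Proj R[It]`, `I = (c_0,…,c_{m−1})`, lies inside some
generator chart `D₊(c_j t)` whose chart ring `(R[It])_{(c_j t)}` is a regular ring, then
`Bl_I(Spec R)` is a regular scheme. [cite: Liu2002, Thm. 8.1.19 (a)] [folklore] -/
theorem isRegular_affineBlowup_of_charts {R : Type u} [CommRing R] {m : ℕ} (c : Fin m → R)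
    (hcover : ∀ i : Fin m, ∃ j : Fin m, IsRegularRing (chartRing c j) ∧
      Proj.basicOpen (reesGrading (Ideal.span (Set.range c)))
          (reesT (c i) (Ideal.mem_span_range_self (f := c) (x := i))) ≤
        Proj.basicOpen (reesGrading (Ideal.span (Set.range c)))
          (reesT (c j) (Ideal.mem_span_range_self (f := c) (x := j)))) :
    Scheme.IsRegular (affineBlowup (Ideal.span (Set.range c))) := by
  refine Scheme.IsRegular.of_forall_exists_isOpenImmersion fun p => ?_
  have hp : p ∈ (⨆ i : Fin m, Proj.basicOpen (reesGrading (Ideal.span (Set.range c)))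
      (reesT (c i) (Ideal.mem_span_range_self (f := c) (x := i)))) := by
    rw [affineBlowup.iSup_basicOpen_reesT_generators_eq_top c]; trivial
  obtain ⟨i, hi⟩ := Opens.mem_iSup.mp hp
  obtain ⟨j, hj, hij⟩ := hcover i
  haveI : IsRegularRing (CommRingCat.of (chartRing c j)) := hj
  refine ⟨_, Proj.awayι (reesGrading (Ideal.span (Set.range c)))
    (reesT (c j) (Ideal.mem_span_range_self (f := c) (x := j)))
    (reesT_mem (c j) (Ideal.mem_span_range_self (f := c) (x := j))) Nat.one_pos,
    inferInstance, ?_, Scheme.isRegular_Spec _⟩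
  rw [← Scheme.Hom.coe_opensRange, Proj.opensRange_awayι]
  exact hij hi

section K3

variable (k : Type) [Field k] (n : ℕ) (a b : Fin n)

set_option maxHeartbeats 400000 in
/-- In the Rees algebra of `K₃`: `(x_a²x_b³ t)² = (x_a³x_b t) · (x_b · x_a x_b⁴ t)`. [folklore] -/
theorem reesT_k3_two_sq :
    reesT ((![X a ^ 4, X a ^ 3 * X b, X a ^ 2 * X b ^ 3, X a * X b ^ 4, X b ^ 6] :
        Fin 5 → MvPolynomial (Fin n) k) 2) (Ideal.mem_span_range_self
      (f := (![X a ^ 4, X a ^ 3 * X b, X a ^ 2 * X b ^ 3, X a * X b ^ 4, X b ^ 6] :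
        Fin 5 → MvPolynomial (Fin n) k)) (x := 2)) ^ 2 =
    reesT ((![X a ^ 4, X a ^ 3 * X b, X a ^ 2 * X b ^ 3, X a * X b ^ 4, X b ^ 6] :
        Fin 5 → MvPolynomial (Fin n) k) 1) (Ideal.mem_span_range_self
      (f := (![X a ^ 4, X a ^ 3 * X b, X a ^ 2 * X b ^ 3, X a * X b ^ 4, X b ^ 6] :
        Fin 5 → MvPolynomial (Fin n) k)) (x := 1)) *
      (algebraMap (MvPolynomial (Fin n) k) _ (X b) *
        reesT ((![X a ^ 4, X a ^ 3 * X b, X a ^ 2 * X b ^ 3, X a * X b ^ 4, X b ^ 6] :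
          Fin 5 → MvPolynomial (Fin n) k) 3) (Ideal.mem_span_range_self
        (f := (![X a ^ 4, X a ^ 3 * X b, X a ^ 2 * X b ^ 3, X a * X b ^ 4, X b ^ 6] :
          Fin 5 → MvPolynomial (Fin n) k)) (x := 3))) := by
  apply Subtype.ext
  simp only [Subalgebra.coe_pow, Subalgebra.coe_mul, Subalgebra.coe_algebraMap, coe_reesT,
    Polynomial.algebraMap_eq, Polynomial.monomial_pow, Polynomial.C_mul_monomial,
    Polynomial.monomial_mul_monomial]
  change Polynomial.monomial (1 * 2) ((X a ^ 2 * X b ^ 3) ^ 2) =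
    Polynomial.monomial (1 + 1) (X a ^ 3 * X b * (X b * (X a * X b ^ 4)))
  congr 1
  ring

/-- **The fifth chart of `Bl_{K₃} 𝔸ⁿ` is redundant**: `D₊(x_a²x_b³ t) ⊆ D₊(x_a³x_b t)` (it is the
torus chart). [folklore] -/
theorem basicOpen_k3_two_le :
    Proj.basicOpen (reesGrading (Ideal.span (Set.range
        (![X a ^ 4, X a ^ 3 * X b, X a ^ 2 * X b ^ 3, X a * X b ^ 4, X b ^ 6] :
          Fin 5 → MvPolynomial (Fin n) k))))
      (reesT ((![X a ^ 4, X a ^ 3 * X b, X a ^ 2 * X b ^ 3, X a * X b ^ 4, X b ^ 6] :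
          Fin 5 → MvPolynomial (Fin n) k) 2) (Ideal.mem_span_range_self
        (f := (![X a ^ 4, X a ^ 3 * X b, X a ^ 2 * X b ^ 3, X a * X b ^ 4, X b ^ 6] :
          Fin 5 → MvPolynomial (Fin n) k)) (x := 2))) ≤
    Proj.basicOpen (reesGrading (Ideal.span (Set.range
        (![X a ^ 4, X a ^ 3 * X b, X a ^ 2 * X b ^ 3, X a * X b ^ 4, X b ^ 6] :
          Fin 5 → MvPolynomial (Fin n) k))))
      (reesT ((![X a ^ 4, X a ^ 3 * X b, X a ^ 2 * X b ^ 3, X a * X b ^ 4, X b ^ 6] :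
          Fin 5 → MvPolynomial (Fin n) k) 1) (Ideal.mem_span_range_self
        (f := (![X a ^ 4, X a ^ 3 * X b, X a ^ 2 * X b ^ 3, X a * X b ^ 4, X b ^ 6] :
          Fin 5 → MvPolynomial (Fin n) k)) (x := 1))) := by
  rw [← Proj.basicOpen_pow _ _ 2 two_pos, reesT_k3_two_sq, Proj.basicOpen_mul]
  exact inf_le_left

/-- **`Bl_{K₃} 𝔸ⁿ` is regular, integral, and proper birational over `𝔸ⁿ`, given its four
Newton-vertex charts** (`j = 0` A, `j = 1` B2a, `j = 3` B2b, `j = 4` B1; the fifth chart lies in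
B2a). The conclusion is the `(V, π)`-half of the terminal-model package consumed by
`JordanThree.v3_hasResolution_of_model` (p479205). [OURS · L1 W4.5c] -/
theorem k3_blowup_regular_of_charts
    (h0 : IsRegularRing (chartRing
      (![X a ^ 4, X a ^ 3 * X b, X a ^ 2 * X b ^ 3, X a * X b ^ 4, X b ^ 6] :
        Fin 5 → MvPolynomial (Fin n) k) 0))
    (h1 : IsRegularRing (chartRing
      (![X a ^ 4, X a ^ 3 * X b, X a ^ 2 * X b ^ 3, X a * X b ^ 4, X b ^ 6] :
        Fin 5 → MvPolynomial (Fin n) k) 1))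
    (h3 : IsRegularRing (chartRing
      (![X a ^ 4, X a ^ 3 * X b, X a ^ 2 * X b ^ 3, X a * X b ^ 4, X b ^ 6] :
        Fin 5 → MvPolynomial (Fin n) k) 3))
    (h4 : IsRegularRing (chartRing
      (![X a ^ 4, X a ^ 3 * X b, X a ^ 2 * X b ^ 3, X a * X b ^ 4, X b ^ 6] :
        Fin 5 → MvPolynomial (Fin n) k) 4)) :
    Scheme.IsRegular (affineBlowup (Ideal.span (Set.range
        (![X a ^ 4, X a ^ 3 * X b, X a ^ 2 * X b ^ 3, X a * X b ^ 4, X b ^ 6] :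
          Fin 5 → MvPolynomial (Fin n) k)))) ∧
      IsIntegral (affineBlowup (Ideal.span (Set.range
        (![X a ^ 4, X a ^ 3 * X b, X a ^ 2 * X b ^ 3, X a * X b ^ 4, X b ^ 6] :
          Fin 5 → MvPolynomial (Fin n) k)))) ∧
      IsProper (affineBlowup.π (Ideal.span (Set.range
        (![X a ^ 4, X a ^ 3 * X b, X a ^ 2 * X b ^ 3, X a * X b ^ 4, X b ^ 6] :
          Fin 5 → MvPolynomial (Fin n) k)))) ∧
      IsBirational (affineBlowup.π (Ideal.span (Set.range
        (![X a ^ 4, X a ^ 3 * X b, X a ^ 2 * X b ^ 3, X a * X b ^ 4, X b ^ 6] :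
          Fin 5 → MvPolynomial (Fin n) k)))) := by
  have hne : Ideal.span (Set.range
      (![X a ^ 4, X a ^ 3 * X b, X a ^ 2 * X b ^ 3, X a * X b ^ 4, X b ^ 6] :
        Fin 5 → MvPolynomial (Fin n) k)) ≠ ⊥ := by
    intro h
    rw [Ideal.span_eq_bot] at h
    exact pow_ne_zero 4 (X_ne_zero a) (h _ ⟨0, rfl⟩)
  refine ⟨isRegular_affineBlowup_of_charts _ fun i => ?_, affineBlowup.isIntegral hne,
    inferInstance, affineBlowup.isBirational hne⟩
  fin_cases i
  · exact ⟨0, h0, le_rfl⟩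
  · exact ⟨1, h1, le_rfl⟩
  · exact ⟨1, h1, basicOpen_k3_two_le k n a b⟩
  · exact ⟨3, h3, le_rfl⟩
  · exact ⟨4, h4, le_rfl⟩

end K3

end Summit.ResolutionOfSingularities.ResolutionOfSingularities.Theorems.WildQuotientResolution.JordanThree

end
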